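/-
Copyright (c) 2026 the pub-hodgecm-mathlib formalisation cell (harness21).  Prover seat hodgecm-mathlib-K2E4-p14 (g10), Track B ∕ K2-LIT, h413 =
`stmt-HodgeConjecture-24833`, ENGINE E1, 5Res campaign «ENDGAME BY FAMILIES», RUNG 1, deal (273)(iii) of K2E1-plan (g7): the OFF-DUAL per-block package of
★ p860902 `residual_invariants_finiteDimensional_letterFree_of_blocks` §3 — FILE 1a, the operator-algebra half (Hecke operator of an off-dual block on `V_P`).
-/
import Summits.HodgeConjecture.HodgeConjecture.Theorems.K2E1MaximalLevelHeckePureTensorBridgeCMTwo     -- ★ p860993∕p861005 FILE 0 (this seat): `exists_archFactor_integratedOperator_eq_arch_comp_level_free`, `ι_∞(K_∞) ⊆ K`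
import Summits.HodgeConjecture.HodgeConjecture.Theorems.K2E1KTypeCompressionAverageU                  -- ★ (K2E2-p12): `exists_spherical_compression`
import Summits.HodgeConjecture.HodgeConjecture.Theorems.K2E1KTypeProjectorPureTensorU                  -- ★ (K2E2-p12): `kType_comp_self`, `level_comp_self`, `adjoint_kType`, `kType_comm_integratedOperator`
import Summits.HodgeConjecture.HodgeConjecture.Theorems.K2E1ChiSectionHeckeStableCMTwo                 -- ★ B1 (K2E1-p11): `eisensteinSeriesU_radialSection_quotientSubgroup_mul` (+ `IsChiSection`, `chiSectionSpace`, `borelHeight`)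
import Summits.HodgeConjecture.HodgeConjecture.Theorems.K2E1ArchSymbolCirclePhaseU2                     -- ★ p860525 (K2-defs1): `exists_gauge_symbol_two` (+ ★ `selfConv_gaugeWeight_eq_pureTensor`, ★ `continuous_selfConv`)
import Summits.HodgeConjecture.HodgeConjecture.Theorems.K2E1BlockHeckeTBLetterFreeCMTwo                   -- ★ p860686 (K2E2-p12): `compactSpace_archUnitaryPoints`
import Mathlib.Analysis.InnerProductSpace.Projection.Basic
import HarnessLib

/-!
# K2·E1 — `K2E1ResidualBlockPackageOffDualHeckeCMTwo`: THE HECKE OPERATOR OF AN OFF-DUAL BLOCK IN ★ p860902 §3's CURRENCY (FILE 1a of the off-dual block package, RUNG 1)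

Track B ∕ K2-LIT, crux h413 = `stmt-HodgeConjecture-24833`, route of record `HCCMUnconditional`; cell `hodgecm-mathlib`, squad K2, ENGINE E1.  Prover seat `hodgecm-mathlib-K2E4-p14` (g10);
deal (273)(iii) of K2E1-plan (g7) (census 14:3xZ + correction after (278)–(281)).  THEOREMS ONLY (no `def`, no `instance`, no notation, no named-fact hypothesis, no `sorry`); lane
`--supports stmt-HodgeConjecture-24833 --as helper` (count-neutral).  CLOSES NO SOCKET.  Frame: `quasiSplit L⁺ L c 2 = U(J₂)` (`= cmDatum L 2 J₂` rfl), `K_∞ = U(J₂)(L⁺ ⊗ ℝ) ∩ U(1 ⊗ 1)`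
(K2E2-p12's frame of ★ p860902 §4), `K = K_∞·GL₂(𝒪̂_L)` the adelic maximal compact (`comap adelicVal standardMaximalCompactGL`).

THE MATHEMATICS ([Knapp1986, VIII §3]; [Gelbart1975, (10.12)–(10.13)]; [Bump1997, proof of Lemma 2.3.2]; [BernsteinLapid2019, §4 Claim 1]).  ★ p860902 §3 binds, per block, a Hecke operator
`T_j = R_∞(h_j) ∘L R_f(e)` with `h_j ∈ C_c(G_∞)` SPHERICAL (`hhl`∕`hhr`) and asks for `hU` only on `V_P = Fix(P)`, `P = P_1 ∘L R_f(e)`.  For an OFF-DUAL block of ANY archimedean type (the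
infinitely many `χ_t = ∏_w |·|_w^{it_w}` of (278)(B) have `χ_∞ ≠ 1`, so the (M1) convData scalar action does not serve them) the operator is built as follows.  (§4) The archimedean GAUGE
test function of ★ `exists_gauge_symbol_two` (K2-defs1) gives, for EVERY `χ` and every section level `K_c`, a real symmetric `η ∈ C_c(G(𝔸))` acting on all flat sections of `V(χ, K_c, 1)` by an
ENTIRE NON-CONSTANT symbol; by ★ `selfConv_gaugeWeight_eq_pureTensor` it is right-`K′_f`-invariant and supported in `{y_f ∈ K′_f}` (`K′_f = U₀ ∩ G_f`), so ★ FILE 0 §6 (this seat, p860993∕p861005)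
gives `R(η) = R_∞(a) ∘L R_f(e)`; the arch factor `a` is only `Ad(K_∞)`-central, and ★ `exists_spherical_compression` (K2E2-p12) supplies the SPHERICAL `a♮` with `P_1 R_∞(a) P_1 = R_∞(a♮)`.
(§1) On `V_P` one has `R_f(e) v = v`, `P_1 v = v` (idempotents ★ `kType_comp_self`∕`level_comp_self` commuting by ★ `kType_comm_integratedOperator`), whence (§5 HEAD) **`T v := R_∞(a♮) R_f(e) v =
P_1 (R(η) v)`**.  (§2–§3) The bricks `[θ_{f,φ}]` of level `K_c ⊇ ι_∞(K_∞)` are fixed by every `R(ι_∞ k)` hence by `P_1` (★ `rightRegular_apply_coeFn`, ★ `quotFun_rightTranslation`, left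
`G(F)`-invariance ★ B1), and (§1) a self-adjoint operator fixing a complete subspace is absorbed by its projection: `P_Θ P_1 = P_Θ` — FILE 1b combines this with ★ (y2) `hU_offDual_global_cm_two`
(`U R(η) = σ • U` on ALL of `L²`) to land `hU` in p860902's bytes on `V_P`, and with ★ `hline_of_map_absolutelyContinuous` for `hline`.
* §1 `fix_of_fix_comp`, `compressed_apply_of_fix`, `starProjection_apply_of_selfAdjoint_fix`, `starProjection_congr_of_eq`, `apply_eq_self_of_mem_topologicalClosure_span` (abstract Hilbert space).
* §2 **`rightRegular_apply_brick_eq_self`**.  * §3 `kAverage_apply_brick_eq_self`, **`kAverage_apply_eq_self_of_mem_block`**.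
* §4 **`exists_gauge_selfConv`**, **`exists_offDual_heckeOperator`**.  * §5 HEAD **`exists_offDual_hecke_on_fix`**.
NON-VACUITY (R3∕(278)(0)): no hypothesis asks a subgroup of `G(𝔸)` to be open; at M1 the binders are met by `K_c := K`, `U₀ := GL₂(𝒪̂_L)` (★ `isOpen_glFiniteIntegralLevel`,
★ `isCompact_glFiniteIntegralLevel_holds`), `K′_f := U₀ ∩ G_f`, `hKinfKc := Subgroup.mem_comap`, `hU₀Kc` by ★ `coe_glIntegralLevel_eq_image_ofFinite` — FILE 1b carries the witness.
HONEST LABEL: HC_CM is proved only modulo the 7 printed citations (2 remaining named inputs: hLiu418 = `stmt-HodgeConjecture-24832`, h413 = `stmt-HodgeConjecture-24833`) until rung 0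
closes; this file asserts no named fact and closes no socket; count-neutral; unconditional (structural binders visible: `hVc` continuity of sections, the level data).

## References
* [Knapp1986] A. W. Knapp, *Representation Theory of Semisimple Groups* (1986), VIII §3.
* [Gelbart1975] S. Gelbart, *Automorphic Forms on Adele Groups* (1975), (10.12)–(10.13).
* [Bump1997] D. Bump, *Automorphic Forms and Representations* (1997), proof of Lemma 2.3.2.
* [BernsteinLapid2019] J. Bernstein, E. Lapid, *On the meromorphic continuation of Eisenstein series*, J. AMS 37 (2024), §4 Claim 1.
* [MoeglinWaldspurger1995] C. Mœglin, J.-L. Waldspurger, *Spectral decomposition and Eisenstein series* (1995), II.1.1, II.1.5, VI.2.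
* [ReedSimonI1980] M. Reed, B. Simon, *Methods of Modern Mathematical Physics I* (1980), Thm. II.3.
-/

set_option autoImplicit false
-- the mandated namespace repeats the single-problem summit's segment (`HodgeConjecture.HodgeConjecture`)
set_option linter.dupNamespace false

noncomputable section

open MeasureTheory MeasureTheory.Measure Filter Topology CompactlySupported NumberField NumberField.mixedEmbedding NumberField.InfinitePlace IsDedekindDomain Set
open scoped ENNReal NNReal ComplexConjugate InnerProductSpace
open Literature.NumberTheory Literature.NumberTheory.Automorphic Literature.NumberTheory.Automorphic.UnitaryGroup AdelicGroupData ContRepresentation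
open Literature.NumberTheory.GaloisRepresentations (HeckeCharacter)
open Summit.HodgeConjecture.HodgeConjecture.Cruxes.H413.K2E1BorelEisensteinU
open Summit.HodgeConjecture.HodgeConjecture.Cruxes.H413.K2E1CharacterEisensteinU2Defs
open Summit.HodgeConjecture.HodgeConjecture.Cruxes.H413.K2E1ChiSectionSpaceU2Defs
open Summit.HodgeConjecture.HodgeConjecture.Cruxes.H413.K2E1ChiSectionHeckeStableCMTwo (eisensteinSeriesU_radialSection_quotientSubgroup_mul)
open Summit.HodgeConjecture.HodgeConjecture.Cruxes.H413.K2E1ArchSymbolCirclePhaseU2 (exists_gauge_symbol_two)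
open Summit.HodgeConjecture.HodgeConjecture.Cruxes.H413.K2E1ArchPureTensorSelfConvolutionU2 (isTestFunctionGL_gaugeWeight gaugeWeight_inv selfConv_gaugeWeight_eq_pureTensor)
open Summit.HodgeConjecture.HodgeConjecture.Cruxes.H413.K2E1BLSelfConvolutionU2 (continuous_selfConv hasCompactSupport_selfConv selfConv_inv conj_selfConv)
open Summit.HodgeConjecture.HodgeConjecture.Cruxes.H413.K2E1BlockHeckeTBLetterFreeCMTwo (compactSpace_archUnitaryPoints)
open Summit.HodgeConjecture.HodgeConjecture.Cruxes.H413.K2E1MaximalLevelHeckePureTensorBridgeCMTwo (exists_archFactor_integratedOperator_eq_arch_comp_level_free adelicVal_archToAdelic_inclusion_mem_standardMaximalCompactGL)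
open Summit.HodgeConjecture.HodgeConjecture.Cruxes.H413.K2E1KTypeCompressionAverageU (exists_spherical_compression)

namespace Summit.HodgeConjecture.HodgeConjecture.Cruxes.H413.K2E1ResidualBlockPackageOffDualHeckeCMTwo

/-! ## §1 Operator algebra on the block projector `P = P_1 ∘L E` (abstract bounded operators) -/

section Algebra

variable {H : Type*} [NormedAddCommGroup H] [InnerProductSpace ℂ H]

/-- **`V_P ⊆ Fix(E) ∩ Fix(P_1)`**: if `P_1² = P_1`, `E² = E`, `P_1 E = E P_1` and `P = P_1 ∘L E`, then `P v = v` forces `E v = v` and `P_1 v = v`. [cite: Knapp1986, VIII §3] -/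
theorem fix_of_fix_comp (P₁ E : H →L[ℂ] H) (hP₁ : P₁ ∘L P₁ = P₁) (hE : E ∘L E = E) (hcomm : P₁ ∘L E = E ∘L P₁) {v : H} (hv : (P₁ ∘L E) v = v) :
    E v = v ∧ P₁ v = v := by
  have h1 : E v = v := by
    conv_lhs => rw [← hv]
    rw [ContinuousLinearMap.comp_apply, ← ContinuousLinearMap.comp_apply E P₁, ← hcomm, ContinuousLinearMap.comp_apply, ← ContinuousLinearMap.comp_apply E E, hE]
    exact hv
  refine ⟨h1, ?_⟩
  conv_lhs => rw [← hv]
  rw [ContinuousLinearMap.comp_apply, ← ContinuousLinearMap.comp_apply P₁ P₁, hP₁, h1]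
  have h2 := hv
  rwa [ContinuousLinearMap.comp_apply, h1] at h2

/-- **THE COMPRESSED HECKE OPERATOR ON `V_P`**: with `P_1 ∘L R₁(a) ∘L P_1 = R₁(a♮)` (★ `exists_spherical_compression`) and `R(h) = R₁(a) ∘L E` (★ FILE 0), for `v ∈ V_P`:
`(R₁(a♮) ∘L E) v = P_1 (R(h) v)`. [cite: Knapp1986, VIII §3] [cite: Gelbart1975, (10.12)–(10.13)] -/
theorem compressed_apply_of_fix (P₁ E Ra Ran Rh : H →L[ℂ] H) (hP₁ : P₁ ∘L P₁ = P₁) (hE : E ∘L E = E) (hcomm : P₁ ∘L E = E ∘L P₁)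
    (hcompr : P₁ ∘L Ra ∘L P₁ = Ran) (hbridge : Rh = Ra ∘L E) {v : H} (hv : (P₁ ∘L E) v = v) :
    (Ran ∘L E) v = P₁ (Rh v) := by
  obtain ⟨hEv, hP₁v⟩ := fix_of_fix_comp P₁ E hP₁ hE hcomm hv
  rw [ContinuousLinearMap.comp_apply, hEv, ← hcompr, ContinuousLinearMap.comp_apply, ContinuousLinearMap.comp_apply, hP₁v, hbridge,
    ContinuousLinearMap.comp_apply, hEv]

/-- **A SELF-ADJOINT OPERATOR FIXING A COMPLETE SUBSPACE IS ABSORBED BY ITS PROJECTION**: `P₁† = P₁`, `P₁ t = t` on `Θ` ⟹ `P_Θ (P₁ w) = P_Θ w` for all `w` (`P₁ w − w ⊥ Θ`).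
[cite: ReedSimonI1980, Thm. II.3] -/
theorem starProjection_apply_of_selfAdjoint_fix [CompleteSpace H] (Θ : Submodule ℂ H) [Θ.HasOrthogonalProjection] (P₁ : H →L[ℂ] H)
    (hadj : ContinuousLinearMap.adjoint P₁ = P₁) (hfix : ∀ t ∈ Θ, P₁ t = t) (w : H) :
    Θ.starProjection (P₁ w) = Θ.starProjection w := by
  rw [← sub_eq_zero, ← map_sub, Submodule.starProjection_apply_eq_zero_iff]
  rw [Submodule.mem_orthogonal]
  intro t ht
  rw [inner_sub_right, ← ContinuousLinearMap.adjoint_inner_left, hadj, hfix t ht, sub_self]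

/-- Equal complete subspaces have the same orthogonal projection (pointwise; the instance arguments may differ). [folklore] -/
theorem starProjection_congr_of_eq [CompleteSpace H] (Θ₁ Θ₂ : Submodule ℂ H) [Θ₁.HasOrthogonalProjection] [Θ₂.HasOrthogonalProjection] (h : Θ₁ = Θ₂) (w : H) :
    Θ₁.starProjection w = Θ₂.starProjection w := by
  subst h
  rfl

/-- The fixed space of a bounded operator is closed under limits of spans: if `P₁ t = t` on a set, it holds on the closure of its span. [folklore] -/
theorem apply_eq_self_of_mem_topologicalClosure_span (P₁ : H →L[ℂ] H) {S : Set H} (hS : ∀ t ∈ S, P₁ t = t) :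
    ∀ t ∈ (Submodule.span ℂ S).topologicalClosure, P₁ t = t := by
  intro t ht
  have hle : (Submodule.span ℂ S).topologicalClosure ≤ LinearMap.eqLocus (P₁ : H →ₗ[ℂ] H) LinearMap.id := by
    refine Submodule.topologicalClosure_minimal _ (Submodule.span_le.2 fun s hs => hS s hs) ?_
    exact isClosed_eq P₁.continuous continuous_id
  exact hle ht

end Algebra

/-! ## §2 The bricks `[θ_{f,φ}]` are fixed by `R(k)` for `k` in the level of the sections -/

section Bricks

variable (L : Type) [Field L] [NumberField L] [IsCMField L]
  [MeasurableSpace (quasiSplit (↥(maximalRealSubfield L)) L (IsCMField.complexConj L) 2).Adelic] [BorelSpace (quasiSplit (↥(maximalRealSubfield L)) L (IsCMField.complexConj L) 2).Adelic]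
  (μ : Measure (quasiSplit (↥(maximalRealSubfield L)) L (IsCMField.complexConj L) 2).automorphicQuotient) [(quasiSplit (↥(maximalRealSubfield L)) L (IsCMField.complexConj L) 2).IsAutomorphicMeasure μ]

/-- **`R(k)[θ_{f,φ}] = [θ_{f,φ}]`** for `k ∈ K_c ≤ K` and `φ ∈ V(χ, K_c, 1)`: the profile `(f∘H)·φ` is right-`k`-invariant (`H(gk) = H(g)`, ★ `borelHeight_mul_of_mem_comap_standardMaximalCompactGL`;
`φ(gk) = φ(g)`), hence so is its Eisenstein series, and `(R(k)[Φ])(x) = [Φ](k⁻¹•x) = [Φ(·k)](x)` (★ `rightRegular_apply_coeFn`, ★ `quotFun_rightTranslation`, left-`G(F)`-invariance ★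
`eisensteinSeriesU_radialSection_quotientSubgroup_mul`). [cite: MoeglinWaldspurger1995, II.1.1, II.1.5] [cite: BorelJacquet1979, §4.6] -/
theorem rightRegular_apply_brick_eq_self {χ : HeckeCharacter L} {Kc : Subgroup (quasiSplit (↥(maximalRealSubfield L)) L (IsCMField.complexConj L) 2).Adelic}
    (hKcK : Kc ≤ ((standardMaximalCompactGL 2 L).comap (adelicVal (↥(maximalRealSubfield L)) L (IsCMField.complexConj L) 2 ((StdForm.antidiagonal 2).over L)) : Subgroup (quasiSplit (↥(maximalRealSubfield L)) L (IsCMField.complexConj L) 2).Adelic))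
    {f : ℝ → ℂ} {φ : (quasiSplit (↥(maximalRealSubfield L)) L (IsCMField.complexConj L) 2).Adelic → ℂ} (hφ : φ ∈ chiSectionSpace χ Kc 1)
    (hv : MemLp ((quasiSplit (↥(maximalRealSubfield L)) L (IsCMField.complexConj L) 2).quotFun (eisensteinSeriesU (fun g : (quasiSplit (↥(maximalRealSubfield L)) L (IsCMField.complexConj L) 2).Adelic => f (borelHeight g : ℝ) * φ g))) 2 μ)
    {k : (quasiSplit (↥(maximalRealSubfield L)) L (IsCMField.complexConj L) 2).Adelic} (hk : k ∈ Kc) :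
    ((quasiSplit (↥(maximalRealSubfield L)) L (IsCMField.complexConj L) 2).rightRegular μ) k (hv.toLp _) = hv.toLp _ := by
  -- the profile and its Eisenstein series are right-`k`-invariant
  have hF : ∀ g : (quasiSplit (↥(maximalRealSubfield L)) L (IsCMField.complexConj L) 2).Adelic, f (borelHeight (g * k) : ℝ) * φ (g * k) = f (borelHeight g : ℝ) * φ g := fun g => by
    rw [borelHeight_mul_of_mem_comap_standardMaximalCompactGL (hKcK hk) g, ((mem_chiSectionSpace_iff φ).1 hφ).2 g ⟨k, hk⟩, Pi.one_apply, one_mul]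
  have hE : ∀ g : (quasiSplit (↥(maximalRealSubfield L)) L (IsCMField.complexConj L) 2).Adelic, eisensteinSeriesU (fun g : (quasiSplit (↥(maximalRealSubfield L)) L (IsCMField.complexConj L) 2).Adelic => f (borelHeight g : ℝ) * φ g) (g * k) = eisensteinSeriesU (fun g : (quasiSplit (↥(maximalRealSubfield L)) L (IsCMField.complexConj L) 2).Adelic => f (borelHeight g : ℝ) * φ g) g := fun g => by
    rw [eisensteinSeriesU_def, eisensteinSeriesU_def]
    exact tsum_congr fun q => by rw [← mul_assoc]; exact hF _
  -- `(R(k)[Φ])(x) = [Φ](k⁻¹ • x) = quotFun (Φ(·k)) x = [Φ](x)`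
  have hinv := eisensteinSeriesU_radialSection_quotientSubgroup_mul L ((mem_chiSectionSpace_iff φ).1 hφ).1 f
  have hrt : rightTranslation (quasiSplit (↥(maximalRealSubfield L)) L (IsCMField.complexConj L) 2) k (eisensteinSeriesU (fun g : (quasiSplit (↥(maximalRealSubfield L)) L (IsCMField.complexConj L) 2).Adelic => f (borelHeight g : ℝ) * φ g)) =
      eisensteinSeriesU (fun g : (quasiSplit (↥(maximalRealSubfield L)) L (IsCMField.complexConj L) 2).Adelic => f (borelHeight g : ℝ) * φ g) := funext fun g => by rw [rightTranslation_apply, hE]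
  have h3 := AdelicGroupData.quotFun_rightTranslation hinv k
  rw [hrt] at h3
  apply Lp.ext
  have h1 := (quasiSplit (↥(maximalRealSubfield L)) L (IsCMField.complexConj L) 2).rightRegular_apply_coeFn μ k (hv.toLp _)
  have h2 := (measurePreserving_smul k⁻¹ μ).quasiMeasurePreserving.ae_eq_comp hv.coeFn_toLp
  refine h1.trans (h2.trans ?_)
  refine Filter.EventuallyEq.trans (Filter.Eventually.of_forall fun x => ?_) hv.coeFn_toLp.symm
  exact (congrFun h3 x).symm

end Bricks

/-! ## §3 The `K_∞`-average `P_1` fixes every brick of level `K_c ⊇ ι_∞(K_∞)`, hence the whole block -/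

section KAverage

variable (L : Type) [Field L] [NumberField L] [IsCMField L]
  [MeasurableSpace (quasiSplit (↥(maximalRealSubfield L)) L (IsCMField.complexConj L) 2).Adelic] [BorelSpace (quasiSplit (↥(maximalRealSubfield L)) L (IsCMField.complexConj L) 2).Adelic]
  (μ : Measure (quasiSplit (↥(maximalRealSubfield L)) L (IsCMField.complexConj L) 2).automorphicQuotient) [(quasiSplit (↥(maximalRealSubfield L)) L (IsCMField.complexConj L) 2).IsAutomorphicMeasure μ]
  [MeasurableSpace ↥(UnitaryGroup.arch (↥(maximalRealSubfield L)) L (IsCMField.complexConj L) 2 ((StdForm.antidiagonal 2).over L) ⊓ unitaryGroupOfForm (conjMixed (↥(maximalRealSubfield L)) L (IsCMField.complexConj L)) 1)] [BorelSpace ↥(UnitaryGroup.arch (↥(maximalRealSubfield L)) L (IsCMField.complexConj L) 2 ((StdForm.antidiagonal 2).over L) ⊓ unitaryGroupOfForm (conjMixed (↥(maximalRealSubfield L)) L (IsCMField.complexConj L)) 1)]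
  (μK : Measure ↥(UnitaryGroup.arch (↥(maximalRealSubfield L)) L (IsCMField.complexConj L) 2 ((StdForm.antidiagonal 2).over L) ⊓ unitaryGroupOfForm (conjMixed (↥(maximalRealSubfield L)) L (IsCMField.complexConj L)) 1)) [IsProbabilityMeasure μK]
  (χ₁ : C_c(↥(UnitaryGroup.arch (↥(maximalRealSubfield L)) L (IsCMField.complexConj L) 2 ((StdForm.antidiagonal 2).over L) ⊓ unitaryGroupOfForm (conjMixed (↥(maximalRealSubfield L)) L (IsCMField.complexConj L)) 1), ℂ))

/-- **`P_1 [θ_{f,φ}] = [θ_{f,φ}]`** for the `K_∞`-average `P_1 = ∫_{K_∞} χ₁(k) R(ι_∞ k) dμ_K` at the trivial `K_∞`-type (`χ₁ ≡ 1`, `μ_K` a probability measure), whenever `ι_∞(K_∞) ⊆ K_c ≤ K` and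
`φ ∈ V(χ, K_c, 1)` (§2: each `R(ι_∞ k)` fixes the brick). [cite: Knapp1986, VIII §3] [cite: MoeglinWaldspurger1995, II.1.1] -/
theorem kAverage_apply_brick_eq_self (hχ1 : ∀ k, χ₁ k = 1) {χ : HeckeCharacter L} {Kc : Subgroup (quasiSplit (↥(maximalRealSubfield L)) L (IsCMField.complexConj L) 2).Adelic}
    (hKcK : Kc ≤ ((standardMaximalCompactGL 2 L).comap (adelicVal (↥(maximalRealSubfield L)) L (IsCMField.complexConj L) 2 ((StdForm.antidiagonal 2).over L)) : Subgroup (quasiSplit (↥(maximalRealSubfield L)) L (IsCMField.complexConj L) 2).Adelic))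
    (hKinfKc : ∀ k : ↥(UnitaryGroup.arch (↥(maximalRealSubfield L)) L (IsCMField.complexConj L) 2 ((StdForm.antidiagonal 2).over L) ⊓ unitaryGroupOfForm (conjMixed (↥(maximalRealSubfield L)) L (IsCMField.complexConj L)) 1), archToAdelic (↥(maximalRealSubfield L)) L (IsCMField.complexConj L) 2 ((StdForm.antidiagonal 2).over L) ((Subgroup.inclusion (inf_le_left : UnitaryGroup.arch (↥(maximalRealSubfield L)) L (IsCMField.complexConj L) 2 ((StdForm.antidiagonal 2).over L) ⊓ unitaryGroupOfForm (conjMixed (↥(maximalRealSubfield L)) L (IsCMField.complexConj L)) 1 ≤ UnitaryGroup.arch (↥(maximalRealSubfield L)) L (IsCMField.complexConj L) 2 ((StdForm.antidiagonal 2).over L))) k) ∈ Kc)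
    {f : ℝ → ℂ} {φ : (quasiSplit (↥(maximalRealSubfield L)) L (IsCMField.complexConj L) 2).Adelic → ℂ} (hφ : φ ∈ chiSectionSpace χ Kc 1)
    (hv : MemLp ((quasiSplit (↥(maximalRealSubfield L)) L (IsCMField.complexConj L) 2).quotFun (eisensteinSeriesU (fun g : (quasiSplit (↥(maximalRealSubfield L)) L (IsCMField.complexConj L) 2).Adelic => f (borelHeight g : ℝ) * φ g))) 2 μ) :
    (((quasiSplit (↥(maximalRealSubfield L)) L (IsCMField.complexConj L) 2).rightRegular μ).restrict ((archToAdelic (↥(maximalRealSubfield L)) L (IsCMField.complexConj L) 2 ((StdForm.antidiagonal 2).over L)).comp (Subgroup.inclusion (inf_le_left : UnitaryGroup.arch (↥(maximalRealSubfield L)) L (IsCMField.complexConj L) 2 ((StdForm.antidiagonal 2).over L) ⊓ unitaryGroupOfForm (conjMixed (↥(maximalRealSubfield L)) L (IsCMField.complexConj L)) 1 ≤ UnitaryGroup.arch (↥(maximalRealSubfield L)) L (IsCMField.complexConj L) 2 ((StdForm.antidiagonal 2).over L))))).integratedOperator (((quasiSplit (↥(maximalRealSubfield L)) L (IsCMField.complexConj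 L) 2).isUnitary_rightRegular μ).restrict _) (((quasiSplit (↥(maximalRealSubfield L)) L (IsCMField.complexConj L) 2).isStronglyContinuous_rightRegular_holds μ).restrict _ ((continuous_archToAdelic (↥(maximalRealSubfield L)) L (IsCMField.complexConj L) 2 ((StdForm.antidiagonal 2).over L)).comp (continuous_induced_rng.2 continuous_subtype_val))) μK χ₁ (hv.toLp _) = hv.toLp _ := by
  rw [ContRepresentation.integratedOperator_apply]
  have h : (fun k : ↥(UnitaryGroup.arch (↥(maximalRealSubfield L)) L (IsCMField.complexConj L) 2 ((StdForm.antidiagonal 2).over L) ⊓ unitaryGroupOfForm (conjMixed (↥(maximalRealSubfield L)) L (IsCMField.complexConj L)) 1) => χ₁ k • (((quasiSplit (↥(maximalRealSubfield L)) L (IsCMField.complexConj L) 2).rightRegular μ).restrict ((archToAdelic (↥(maximalRealSubfield L)) L (IsCMField.complexConj L) 2 ((StdForm.antidiagonal 2).over L)).comp (Subgroup.inclusion (inf_le_left : UnitaryGroup.arch (↥(maximalRealSubfield L)) L (IsCMField.complexConj L) 2 ((StdForm.antidiagonal 2).over L) ⊓ unitaryGroupOfForm (conjMixed (↥(maximalRealSubfield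 L)) L (IsCMField.complexConj L)) 1 ≤ UnitaryGroup.arch (↥(maximalRealSubfield L)) L (IsCMField.complexConj L) 2 ((StdForm.antidiagonal 2).over L))))) k (hv.toLp _)) = fun _ => hv.toLp _ := by
    funext k
    rw [ContRepresentation.restrict_apply, MonoidHom.comp_apply, rightRegular_apply_brick_eq_self L μ hKcK hφ hv (hKinfKc k), hχ1, one_smul]
  rw [h, integral_const, probReal_univ]
  exact one_smul _ _

/-- **`P_1` FIXES THE WHOLE BLOCK**: every element of the closed span of the level-`K_c` bricks `{[θ_{f,φ}] : f ∈ C_c((0,∞)), φ ∈ V(χ, K_c, 1) continuous}` is fixed by `P_1` (§1 closure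
lemma). [cite: Knapp1986, VIII §3] [cite: MoeglinWaldspurger1995, II.1.1] -/
theorem kAverage_apply_eq_self_of_mem_block (hχ1 : ∀ k, χ₁ k = 1) {χ : HeckeCharacter L} {Kc : Subgroup (quasiSplit (↥(maximalRealSubfield L)) L (IsCMField.complexConj L) 2).Adelic}
    (hKcK : Kc ≤ ((standardMaximalCompactGL 2 L).comap (adelicVal (↥(maximalRealSubfield L)) L (IsCMField.complexConj L) 2 ((StdForm.antidiagonal 2).over L)) : Subgroup (quasiSplit (↥(maximalRealSubfield L)) L (IsCMField.complexConj L) 2).Adelic))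
    (hKinfKc : ∀ k : ↥(UnitaryGroup.arch (↥(maximalRealSubfield L)) L (IsCMField.complexConj L) 2 ((StdForm.antidiagonal 2).over L) ⊓ unitaryGroupOfForm (conjMixed (↥(maximalRealSubfield L)) L (IsCMField.complexConj L)) 1), archToAdelic (↥(maximalRealSubfield L)) L (IsCMField.complexConj L) 2 ((StdForm.antidiagonal 2).over L) ((Subgroup.inclusion (inf_le_left : UnitaryGroup.arch (↥(maximalRealSubfield L)) L (IsCMField.complexConj L) 2 ((StdForm.antidiagonal 2).over L) ⊓ unitaryGroupOfForm (conjMixed (↥(maximalRealSubfield L)) L (IsCMField.complexConj L)) 1 ≤ UnitaryGroup.arch (↥(maximalRealSubfield L)) L (IsCMField.complexConj L) 2 ((StdForm.antidiagonal 2).over L))) k) ∈ Kc) :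
    ∀ t ∈ (Submodule.span ℂ {v : (quasiSplit (↥(maximalRealSubfield L)) L (IsCMField.complexConj L) 2).L2 μ |
        ∃ (f : ℝ → ℂ) (_ : Continuous f) (_ : HasCompactSupport f) (_ : tsupport f ⊆ Ioi 0)
          (φ : (quasiSplit (↥(maximalRealSubfield L)) L (IsCMField.complexConj L) 2).Adelic → ℂ) (_ : φ ∈ chiSectionSpace χ Kc 1) (_ : Continuous φ)
          (hv : MemLp ((quasiSplit (↥(maximalRealSubfield L)) L (IsCMField.complexConj L) 2).quotFun (eisensteinSeriesU (fun g => f (borelHeight g) * φ g))) 2 μ), v = hv.toLp _}).topologicalClosure,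
      (((quasiSplit (↥(maximalRealSubfield L)) L (IsCMField.complexConj L) 2).rightRegular μ).restrict ((archToAdelic (↥(maximalRealSubfield L)) L (IsCMField.complexConj L) 2 ((StdForm.antidiagonal 2).over L)).comp (Subgroup.inclusion (inf_le_left : UnitaryGroup.arch (↥(maximalRealSubfield L)) L (IsCMField.complexConj L) 2 ((StdForm.antidiagonal 2).over L) ⊓ unitaryGroupOfForm (conjMixed (↥(maximalRealSubfield L)) L (IsCMField.complexConj L)) 1 ≤ UnitaryGroup.arch (↥(maximalRealSubfield L)) L (IsCMField.complexConj L) 2 ((StdForm.antidiagonal 2).over L))))).integratedOperator (((quasiSplit (↥(maximalRealSubfield L)) L (IsCMField.complexConj L) 2).isUnitary_rightRegular μ).restrict _) (((quasiSplit (↥(maximalRealSubfield L)) L (IsCMField.complexConj L) 2).isStronglyContinuous_rightRegular_holds μ).restrict _ ((continuous_archToAdelic (↥(maximalRealSubfield L)) L (IsCMField.complexConj L) 2 ((StdForm.antidiagonal 2).over L)).comp (continuous_induced_rng.2 continuous_subtype_val))) μK χ₁ t = t := by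
  refine apply_eq_self_of_mem_topologicalClosure_span _ ?_
  rintro t ⟨f, -, -, -, φ, hφ, -, hv, rfl⟩
  exact kAverage_apply_brick_eq_self L μ μK χ₁ hχ1 hKcK hKinfKc hφ hv

end KAverage

/-! ## §4 The Hecke operator of an off-dual block: gauge self-convolution → pure tensor (FILE 0) → spherical compression -/

section Hecke

variable (L : Type) [Field L] [NumberField L] [IsCMField L]
  [MeasurableSpace (quasiSplit (↥(maximalRealSubfield L)) L (IsCMField.complexConj L) 2).Adelic] [BorelSpace (quasiSplit (↥(maximalRealSubfield L)) L (IsCMField.complexConj L) 2).Adelic]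
  (μ : Measure (quasiSplit (↥(maximalRealSubfield L)) L (IsCMField.complexConj L) 2).automorphicQuotient) [(quasiSplit (↥(maximalRealSubfield L)) L (IsCMField.complexConj L) 2).IsAutomorphicMeasure μ]
  [MeasurableSpace (UnitaryGroup.arch (↥(maximalRealSubfield L)) L (IsCMField.complexConj L) 2 ((StdForm.antidiagonal 2).over L))] [BorelSpace (UnitaryGroup.arch (↥(maximalRealSubfield L)) L (IsCMField.complexConj L) 2 ((StdForm.antidiagonal 2).over L))]
  [MeasurableSpace (finAdelic (↥(maximalRealSubfield L)) L (IsCMField.complexConj L) 2 ((StdForm.antidiagonal 2).over L))] [BorelSpace (finAdelic (↥(maximalRealSubfield L)) L (IsCMField.complexConj L) 2 ((StdForm.antidiagonal 2).over L))]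
  (νinf : Measure (UnitaryGroup.arch (↥(maximalRealSubfield L)) L (IsCMField.complexConj L) 2 ((StdForm.antidiagonal 2).over L))) [IsHaarMeasure νinf] [νinf.IsInvInvariant] [SFinite νinf]
  (νf : Measure (finAdelic (↥(maximalRealSubfield L)) L (IsCMField.complexConj L) 2 ((StdForm.antidiagonal 2).over L))) [IsHaarMeasure νf] [SFinite νf]
  (νG : Measure (quasiSplit (↥(maximalRealSubfield L)) L (IsCMField.complexConj L) 2).Adelic) [νG.IsHaarMeasure]
  [MeasurableSpace ↥(UnitaryGroup.arch (↥(maximalRealSubfield L)) L (IsCMField.complexConj L) 2 ((StdForm.antidiagonal 2).over L) ⊓ unitaryGroupOfForm (conjMixed (↥(maximalRealSubfield L)) L (IsCMField.complexConj L)) 1)] [BorelSpace ↥(UnitaryGroup.arch (↥(maximalRealSubfield L)) L (IsCMField.complexConj L) 2 ((StdForm.antidiagonal 2).over L) ⊓ unitaryGroupOfForm (conjMixed (↥(maximalRealSubfield L)) L (IsCMField.complexConj L)) 1)]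
  (μK : Measure ↥(UnitaryGroup.arch (↥(maximalRealSubfield L)) L (IsCMField.complexConj L) 2 ((StdForm.antidiagonal 2).over L) ⊓ unitaryGroupOfForm (conjMixed (↥(maximalRealSubfield L)) L (IsCMField.complexConj L)) 1)) [IsProbabilityMeasure μK] [μK.IsMulLeftInvariant] [μK.IsMulRightInvariant]
  (χ₁ : C_c(↥(UnitaryGroup.arch (↥(maximalRealSubfield L)) L (IsCMField.complexConj L) 2 ((StdForm.antidiagonal 2).over L) ⊓ unitaryGroupOfForm (conjMixed (↥(maximalRealSubfield L)) L (IsCMField.complexConj L)) 1), ℂ)) (e : C_c(finAdelic (↥(maximalRealSubfield L)) L (IsCMField.complexConj L) 2 ((StdForm.antidiagonal 2).over L), ℂ))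

include νinf νf in
omit [SFinite νinf] [SFinite νf] [MeasurableSpace ↥(UnitaryGroup.arch (↥(maximalRealSubfield L)) L (IsCMField.complexConj L) 2 ((StdForm.antidiagonal 2).over L) ⊓ unitaryGroupOfForm (conjMixed (↥(maximalRealSubfield L)) L (IsCMField.complexConj L)) 1)] [BorelSpace ↥(UnitaryGroup.arch (↥(maximalRealSubfield L)) L (IsCMField.complexConj L) 2 ((StdForm.antidiagonal 2).over L) ⊓ unitaryGroupOfForm (conjMixed (↥(maximalRealSubfield L)) L (IsCMField.complexConj L)) 1)] in
/-- **THE GAUGE SELF-CONVOLUTION OF AN OFF-DUAL BLOCK** (★ `exists_gauge_symbol_two` + ★ `selfConv_gaugeWeight_eq_pureTensor`): for every Hecke character `χ` and every level `K_c ≤ K` with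
`ι_∞(K_∞) ∩ K ⊆ K_c` and `ι_f(U₀ ∩ G_f) ⊆ K_c` (`U₀ ≤ GL₂(𝔸_L^∞)` open compact), continuous sections, there is a real symmetric test function `η ∈ C_c(G(𝔸))` (the self-convolution of a
gauge weight) acting on every flat section of `V(χ, K_c, 1)` by an ENTIRE NON-CONSTANT symbol `s`, right-invariant under `ι_f(U₀ ∩ G_f)` and supported in `{y_f ∈ U₀}`.
[cite: Bump1997, proof of Lemma 2.3.2] [cite: BernsteinLapid2019, §4 Claim 1] [cite: Langlands1976, §6] -/
theorem exists_gauge_selfConv {χ : HeckeCharacter L} {Kc : Subgroup (quasiSplit (↥(maximalRealSubfield L)) L (IsCMField.complexConj L) 2).Adelic}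
    (hKcK : Kc ≤ ((standardMaximalCompactGL 2 L).comap (adelicVal (↥(maximalRealSubfield L)) L (IsCMField.complexConj L) 2 ((StdForm.antidiagonal 2).over L)) : Subgroup (quasiSplit (↥(maximalRealSubfield L)) L (IsCMField.complexConj L) 2).Adelic))
    (hKinfKc : ∀ k : UnitaryGroup.arch (↥(maximalRealSubfield L)) L (IsCMField.complexConj L) 2 ((StdForm.antidiagonal 2).over L), adelicVal (↥(maximalRealSubfield L)) L (IsCMField.complexConj L) 2 ((StdForm.antidiagonal 2).over L) (archToAdelic (↥(maximalRealSubfield L)) L (IsCMField.complexConj L) 2 ((StdForm.antidiagonal 2).over L) k) ∈ standardMaximalCompactGL 2 L → archToAdelic (↥(maximalRealSubfield L)) L (IsCMField.complexConj L) 2 ((StdForm.antidiagonal 2).over L) k ∈ Kc)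
    (U₀ : Subgroup (GL (Fin 2) (FiniteAdeleRing (𝓞 L) L))) (hU₀o : IsOpen (U₀ : Set (GL (Fin 2) (FiniteAdeleRing (𝓞 L) L)))) (hU₀c : IsCompact (U₀ : Set (GL (Fin 2) (FiniteAdeleRing (𝓞 L) L))))
    (hU₀Kc : ∀ b : finAdelic (↥(maximalRealSubfield L)) L (IsCMField.complexConj L) 2 ((StdForm.antidiagonal 2).over L), (b : GL (Fin 2) (FiniteAdeleRing (𝓞 L) L)) ∈ U₀ → finAdelicToAdelic (↥(maximalRealSubfield L)) L (IsCMField.complexConj L) 2 ((StdForm.antidiagonal 2).over L) b ∈ Kc)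
    (hVc : ∀ φ ∈ chiSectionSpace χ Kc 1, Continuous φ) :
    ∃ (η : C_c((quasiSplit (↥(maximalRealSubfield L)) L (IsCMField.complexConj L) 2).Adelic, ℂ)) (s : ℂ → ℂ),
      (∀ g, η g⁻¹ = η g) ∧ (∀ g, conj (η g) = η g) ∧ Differentiable ℂ s ∧ (∃ z₁ z₂ : ℂ, s z₁ ≠ s z₂) ∧
      (∀ (z : ℂ), ∀ φ ∈ chiSectionSpace χ Kc 1, ∀ x : (quasiSplit (↥(maximalRealSubfield L)) L (IsCMField.complexConj L) 2).Adelic, (∫ y, η y * flatSectionU φ z (x * y) ∂νG) = s z * flatSectionU φ z x) ∧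
      (∀ b : finAdelic (↥(maximalRealSubfield L)) L (IsCMField.complexConj L) 2 ((StdForm.antidiagonal 2).over L), (b : GL (Fin 2) (FiniteAdeleRing (𝓞 L) L)) ∈ U₀ → ∀ x, η (x * finAdelicToAdelic (↥(maximalRealSubfield L)) L (IsCMField.complexConj L) 2 ((StdForm.antidiagonal 2).over L) b) = η x) ∧
      (∀ y, η y ≠ 0 → ((finPart (↥(maximalRealSubfield L)) L (IsCMField.complexConj L) 2 ((StdForm.antidiagonal 2).over L) y : finAdelic (↥(maximalRealSubfield L)) L (IsCMField.complexConj L) 2 ((StdForm.antidiagonal 2).over L)) : GL (Fin 2) (FiniteAdeleRing (𝓞 L) L)) ∈ U₀) := by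
  haveI : Measure.IsMulRightInvariant νinf := by
    have hinv : Measure.IsMulRightInvariant νinf.inv := inferInstance
    rwa [Measure.inv_eq_self] at hinv
  have hc2 : IsCMField.complexConj L * IsCMField.complexConj L = 1 := AlgEquiv.ext fun x => IsCMField.complexConj_apply_apply L x
  obtain ⟨ψ, s, hsd, -, hnc, hact⟩ := exists_gauge_symbol_two νG νinf νf (IsCMField.complexConj_ne_one L) hc2 (complexConj_smul_infinitePlace L)
    (K' := Kc) (ω := (1 : ↥Kc → ℂ)) hKcK hKinfKc U₀ hU₀o hU₀c (fun b hb => ⟨hU₀Kc b hb, rfl⟩) hVc 0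
  -- the pulled-back gauge weight and its self-convolution as members of `C_c`
  have hemb : Topology.IsClosedEmbedding ⇑(adelicVal (↥(maximalRealSubfield L)) L (IsCMField.complexConj L) 2 ((StdForm.antidiagonal 2).over L)) := (isClosed_adelic (↥(maximalRealSubfield L)) L (IsCMField.complexConj L) 2 ((StdForm.antidiagonal 2).over L)).isClosedEmbedding_subtypeVal
  have hηT := isTestFunctionGL_gaugeWeight ψ U₀ hU₀o hU₀c
  have hηc : Continuous (fun x : (quasiSplit (↥(maximalRealSubfield L)) L (IsCMField.complexConj L) 2).Adelic => (((adelicWeight U₀ (archBump ψ) (adelicVal (↥(maximalRealSubfield L)) L (IsCMField.complexConj L) 2 ((StdForm.antidiagonal 2).over L) x)) : ℝ) : ℂ)) := Complex.continuous_ofReal.comp (hηT.continuous.comp hemb.continuous)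
  have hηs : HasCompactSupport (fun x : (quasiSplit (↥(maximalRealSubfield L)) L (IsCMField.complexConj L) 2).Adelic => (((adelicWeight U₀ (archBump ψ) (adelicVal (↥(maximalRealSubfield L)) L (IsCMField.complexConj L) 2 ((StdForm.antidiagonal 2).over L) x)) : ℝ) : ℂ)) := (hηT.hasCompactSupport.comp_isClosedEmbedding hemb).comp_left Complex.ofReal_zero
  have hhc := continuous_selfConv νG hηc hηs
  have hhs := hasCompactSupport_selfConv νG hηs
  obtain ⟨κ₁, -, hten⟩ := selfConv_gaugeWeight_eq_pureTensor νG νinf νf ψ U₀ hU₀o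
  refine ⟨⟨⟨_, hhc⟩, hhs⟩, s, fun g => ?_, fun g => ?_, hsd, hnc, fun z φ hφ x => hact z φ hφ x, fun b hb x => ?_, fun y hy => ?_⟩
  · exact selfConv_inv νG (fun g => by simp only [map_inv, gaugeWeight_inv]) g
  · exact conj_selfConv νG (fun g => Complex.conj_ofReal _) g
  · change orbitalSmoothing νG (fun x : (quasiSplit (↥(maximalRealSubfield L)) L (IsCMField.complexConj L) 2).Adelic => (((adelicWeight U₀ (archBump ψ) (adelicVal (↥(maximalRealSubfield L)) L (IsCMField.complexConj L) 2 ((StdForm.antidiagonal 2).over L) x)) : ℝ) : ℂ)) (fun x : (quasiSplit (↥(maximalRealSubfield L)) L (IsCMField.complexConj L) 2).Adelic => (((adelicWeight U₀ (archBump ψ) (adelicVal (↥(maximalRealSubfield L)) L (IsCMField.complexConj L) 2 ((StdForm.antidiagonal 2).over L) x)) : ℝ) : ℂ)) (x * finAdelicToAdelic (↥(maximalRealSubfield L)) L (IsCMField.complexConj L) 2 ((StdForm.antidiagonal 2).over L) b) = orbitalSmoothing νG (fun x : (quasiSplit (↥(maximalRealSubfield L)) L (IsCMField.complexConj L) 2).Adelic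 => (((adelicWeight U₀ (archBump ψ) (adelicVal (↥(maximalRealSubfield L)) L (IsCMField.complexConj L) 2 ((StdForm.antidiagonal 2).over L) x)) : ℝ) : ℂ)) (fun x : (quasiSplit (↥(maximalRealSubfield L)) L (IsCMField.complexConj L) 2).Adelic => (((adelicWeight U₀ (archBump ψ) (adelicVal (↥(maximalRealSubfield L)) L (IsCMField.complexConj L) 2 ((StdForm.antidiagonal 2).over L) x)) : ℝ) : ℂ)) x
    rw [hten, hten, map_mul, map_mul, archPart_finAdelicToAdelic, mul_one, finPart_finAdelicToAdelic]
    congr 1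
    have hbU : b ∈ (U₀.subgroupOf (finAdelic (↥(maximalRealSubfield L)) L (IsCMField.complexConj L) 2 ((StdForm.antidiagonal 2).over L))) := Subgroup.mem_subgroupOf.2 hb
    by_cases hy : finPart (↥(maximalRealSubfield L)) L (IsCMField.complexConj L) 2 ((StdForm.antidiagonal 2).over L) x ∈ (U₀.subgroupOf (finAdelic (↥(maximalRealSubfield L)) L (IsCMField.complexConj L) 2 ((StdForm.antidiagonal 2).over L)))
    · rw [Set.indicator_of_mem (show _ ∈ ((U₀.subgroupOf (finAdelic (↥(maximalRealSubfield L)) L (IsCMField.complexConj L) 2 ((StdForm.antidiagonal 2).over L))) : Set (finAdelic (↥(maximalRealSubfield L)) L (IsCMField.complexConj L) 2 ((StdForm.antidiagonal 2).over L))) from hy),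
        Set.indicator_of_mem (show _ ∈ ((U₀.subgroupOf (finAdelic (↥(maximalRealSubfield L)) L (IsCMField.complexConj L) 2 ((StdForm.antidiagonal 2).over L))) : Set (finAdelic (↥(maximalRealSubfield L)) L (IsCMField.complexConj L) 2 ((StdForm.antidiagonal 2).over L))) from Subgroup.mul_mem _ hy hbU)]
    · rw [Set.indicator_of_notMem (show _ ∉ ((U₀.subgroupOf (finAdelic (↥(maximalRealSubfield L)) L (IsCMField.complexConj L) 2 ((StdForm.antidiagonal 2).over L))) : Set (finAdelic (↥(maximalRealSubfield L)) L (IsCMField.complexConj L) 2 ((StdForm.antidiagonal 2).over L))) from hy),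
        Set.indicator_of_notMem (show _ ∉ ((U₀.subgroupOf (finAdelic (↥(maximalRealSubfield L)) L (IsCMField.complexConj L) 2 ((StdForm.antidiagonal 2).over L))) : Set (finAdelic (↥(maximalRealSubfield L)) L (IsCMField.complexConj L) 2 ((StdForm.antidiagonal 2).over L))) from fun h => hy ((Subgroup.mul_mem_cancel_right _ hbU).1 h))]
  · change orbitalSmoothing νG (fun x : (quasiSplit (↥(maximalRealSubfield L)) L (IsCMField.complexConj L) 2).Adelic => (((adelicWeight U₀ (archBump ψ) (adelicVal (↥(maximalRealSubfield L)) L (IsCMField.complexConj L) 2 ((StdForm.antidiagonal 2).over L) x)) : ℝ) : ℂ)) (fun x : (quasiSplit (↥(maximalRealSubfield L)) L (IsCMField.complexConj L) 2).Adelic => (((adelicWeight U₀ (archBump ψ) (adelicVal (↥(maximalRealSubfield L)) L (IsCMField.complexConj L) 2 ((StdForm.antidiagonal 2).over L) x)) : ℝ) : ℂ)) y ≠ 0 at hy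
    rw [hten] at hy
    have hind := right_ne_zero_of_mul hy
    by_contra hnot
    exact hind (Set.indicator_of_notMem (fun h => hnot (Subgroup.mem_subgroupOf.1 h)) _)

/-- **THE HECKE OPERATOR OF AN OFF-DUAL BLOCK IN ★ p860902 §3's CURRENCY.**  With `ν_G = (ν_∞ ⊗ ν_f)` pushed along `(a,b) ↦ (a,1)(1,b)`, the finite level `K′_f = U₀ ∩ G_f` with normalised
idempotent `e`, and the gauge self-convolution `η` of `exists_gauge_selfConv`: there are `a, a♮ ∈ C_c(G_∞)` with **`R(η) = R_∞(a) ∘L R_f(e)`** (★ FILE 0 §6) and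
**`P_1 ∘L R_∞(a) ∘L P_1 = R_∞(a♮)`**, `a♮` SPHERICAL for the trivial `K_∞`-type (★ `exists_spherical_compression`) — so that on `V_P` the operator `T := R_∞(a♮) ∘L R_f(e)` of p860902
acts as `P_1 ∘ R(η)` (§1 `compressed_apply_of_fix`). [cite: Gelbart1975, (10.12)–(10.13)] [cite: Knapp1986, VIII §3] [cite: Bump1997, proof of Lemma 2.3.2] -/
theorem exists_offDual_heckeOperator (hχ1 : ∀ k, χ₁ k = 1)
    (hνG : νG = (νinf.prod νf).map fun q => archToAdelic (↥(maximalRealSubfield L)) L (IsCMField.complexConj L) 2 ((StdForm.antidiagonal 2).over L) q.1 * finAdelicToAdelic (↥(maximalRealSubfield L)) L (IsCMField.complexConj L) 2 ((StdForm.antidiagonal 2).over L) q.2)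
    (K' : Subgroup (finAdelic (↥(maximalRealSubfield L)) L (IsCMField.complexConj L) 2 ((StdForm.antidiagonal 2).over L))) (hK'o : IsOpen (K' : Set (finAdelic (↥(maximalRealSubfield L)) L (IsCMField.complexConj L) 2 ((StdForm.antidiagonal 2).over L))))
    (he0 : ∀ x, x ∉ K' → e x = 0) (he1 : ∫ x, e x ∂νf = 1) (heK : ∀ k ∈ K', ∀ x, e (k * x) = e x)
    (U₀ : Subgroup (GL (Fin 2) (FiniteAdeleRing (𝓞 L) L))) (hU₀o : IsOpen (U₀ : Set (GL (Fin 2) (FiniteAdeleRing (𝓞 L) L)))) (hU₀c : IsCompact (U₀ : Set (GL (Fin 2) (FiniteAdeleRing (𝓞 L) L))))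
    (hK'U₀ : ∀ b : finAdelic (↥(maximalRealSubfield L)) L (IsCMField.complexConj L) 2 ((StdForm.antidiagonal 2).over L), b ∈ K' ↔ (b : GL (Fin 2) (FiniteAdeleRing (𝓞 L) L)) ∈ U₀)
    {χ : HeckeCharacter L} {Kc : Subgroup (quasiSplit (↥(maximalRealSubfield L)) L (IsCMField.complexConj L) 2).Adelic}
    (hKcK : Kc ≤ ((standardMaximalCompactGL 2 L).comap (adelicVal (↥(maximalRealSubfield L)) L (IsCMField.complexConj L) 2 ((StdForm.antidiagonal 2).over L)) : Subgroup (quasiSplit (↥(maximalRealSubfield L)) L (IsCMField.complexConj L) 2).Adelic))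
    (hKinfKc : ∀ k : UnitaryGroup.arch (↥(maximalRealSubfield L)) L (IsCMField.complexConj L) 2 ((StdForm.antidiagonal 2).over L), adelicVal (↥(maximalRealSubfield L)) L (IsCMField.complexConj L) 2 ((StdForm.antidiagonal 2).over L) (archToAdelic (↥(maximalRealSubfield L)) L (IsCMField.complexConj L) 2 ((StdForm.antidiagonal 2).over L) k) ∈ standardMaximalCompactGL 2 L → archToAdelic (↥(maximalRealSubfield L)) L (IsCMField.complexConj L) 2 ((StdForm.antidiagonal 2).over L) k ∈ Kc)
    (hU₀Kc : ∀ b : finAdelic (↥(maximalRealSubfield L)) L (IsCMField.complexConj L) 2 ((StdForm.antidiagonal 2).over L), (b : GL (Fin 2) (FiniteAdeleRing (𝓞 L) L)) ∈ U₀ → finAdelicToAdelic (↥(maximalRealSubfield L)) L (IsCMField.complexConj L) 2 ((StdForm.antidiagonal 2).over L) b ∈ Kc)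
    (hVc : ∀ φ ∈ chiSectionSpace χ Kc 1, Continuous φ) :
    ∃ (η : C_c((quasiSplit (↥(maximalRealSubfield L)) L (IsCMField.complexConj L) 2).Adelic, ℂ)) (s : ℂ → ℂ) (a an : C_c(UnitaryGroup.arch (↥(maximalRealSubfield L)) L (IsCMField.complexConj L) 2 ((StdForm.antidiagonal 2).over L), ℂ)),
      (∀ g, η g⁻¹ = η g) ∧ (∀ g, conj (η g) = η g) ∧ Differentiable ℂ s ∧ (∃ z₁ z₂ : ℂ, s z₁ ≠ s z₂) ∧
      (∀ (z : ℂ), ∀ φ ∈ chiSectionSpace χ Kc 1, ∀ x : (quasiSplit (↥(maximalRealSubfield L)) L (IsCMField.complexConj L) 2).Adelic, (∫ y, η y * flatSectionU φ z (x * y) ∂νG) = s z * flatSectionU φ z x) ∧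
      (∀ (k : ↥(UnitaryGroup.arch (↥(maximalRealSubfield L)) L (IsCMField.complexConj L) 2 ((StdForm.antidiagonal 2).over L) ⊓ unitaryGroupOfForm (conjMixed (↥(maximalRealSubfield L)) L (IsCMField.complexConj L)) 1)) (x : UnitaryGroup.arch (↥(maximalRealSubfield L)) L (IsCMField.complexConj L) 2 ((StdForm.antidiagonal 2).over L)), an ((Subgroup.inclusion (inf_le_left : UnitaryGroup.arch (↥(maximalRealSubfield L)) L (IsCMField.complexConj L) 2 ((StdForm.antidiagonal 2).over L) ⊓ unitaryGroupOfForm (conjMixed (↥(maximalRealSubfield L)) L (IsCMField.complexConj L)) 1 ≤ UnitaryGroup.arch (↥(maximalRealSubfield L)) L (IsCMField.complexConj L) 2 ((StdForm.antidiagonal 2).over L))) k * x) = χ₁ k * an x) ∧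
      (∀ (k : ↥(UnitaryGroup.arch (↥(maximalRealSubfield L)) L (IsCMField.complexConj L) 2 ((StdForm.antidiagonal 2).over L) ⊓ unitaryGroupOfForm (conjMixed (↥(maximalRealSubfield L)) L (IsCMField.complexConj L)) 1)) (x : UnitaryGroup.arch (↥(maximalRealSubfield L)) L (IsCMField.complexConj L) 2 ((StdForm.antidiagonal 2).over L)), an (x * (Subgroup.inclusion (inf_le_left : UnitaryGroup.arch (↥(maximalRealSubfield L)) L (IsCMField.complexConj L) 2 ((StdForm.antidiagonal 2).over L) ⊓ unitaryGroupOfForm (conjMixed (↥(maximalRealSubfield L)) L (IsCMField.complexConj L)) 1 ≤ UnitaryGroup.arch (↥(maximalRealSubfield L)) L (IsCMField.complexConj L) 2 ((StdForm.antidiagonal 2).over L))) k) = χ₁ k * an x) ∧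
      ((quasiSplit (↥(maximalRealSubfield L)) L (IsCMField.complexConj L) 2).rightRegular μ).integratedOperator ((quasiSplit (↥(maximalRealSubfield L)) L (IsCMField.complexConj L) 2).isUnitary_rightRegular μ) ((quasiSplit (↥(maximalRealSubfield L)) L (IsCMField.complexConj L) 2).isStronglyContinuous_rightRegular_holds μ) νG η = (((quasiSplit (↥(maximalRealSubfield L)) L (IsCMField.complexConj L) 2).rightRegular μ).restrict (archToAdelic (↥(maximalRealSubfield L)) L (IsCMField.complexConj L) 2 ((StdForm.antidiagonal 2).over L))).integratedOperator (((quasiSplit (↥(maximalRealSubfield L)) L (IsCMField.complexConj L) 2).isUnitary_rightRegular μ).restrict _) (((quasiSplit (↥(maximalRealSubfield L)) L (IsCMField.complexConj L) 2).isStronglyContinuous_rightRegular_holds μ).restrict _ (continuous_archToAdelic (↥(maximalRealSubfield L)) L (IsCMField.complexConj L) 2 ((StdForm.antidiagonal 2).over L))) νinf a ∘L (((quasiSplit (↥(maximalRealSubfield L)) L (IsCMField.complexConj L) 2).rightRegular μ).restrict (finAdelicToAdelic (↥(maximalRealSubfield L)) L (IsCMField.complexConj L) 2 ((StdForm.antidiagonal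 2).over L))).integratedOperator (((quasiSplit (↥(maximalRealSubfield L)) L (IsCMField.complexConj L) 2).isUnitary_rightRegular μ).restrict _) (((quasiSplit (↥(maximalRealSubfield L)) L (IsCMField.complexConj L) 2).isStronglyContinuous_rightRegular_holds μ).restrict _ (continuous_finAdelicToAdelic (↥(maximalRealSubfield L)) L (IsCMField.complexConj L) 2 ((StdForm.antidiagonal 2).over L))) νf e ∧
      (((quasiSplit (↥(maximalRealSubfield L)) L (IsCMField.complexConj L) 2).rightRegular μ).restrict ((archToAdelic (↥(maximalRealSubfield L)) L (IsCMField.complexConj L) 2 ((StdForm.antidiagonal 2).over L)).comp (Subgroup.inclusion (inf_le_left : UnitaryGroup.arch (↥(maximalRealSubfield L)) L (IsCMField.complexConj L) 2 ((StdForm.antidiagonal 2).over L) ⊓ unitaryGroupOfForm (conjMixed (↥(maximalRealSubfield L)) L (IsCMField.complexConj L)) 1 ≤ UnitaryGroup.arch (↥(maximalRealSubfield L)) L (IsCMField.complexConj L) 2 ((StdForm.antidiagonal 2).over L))))).integratedOperator (((quasiSplit (↥(maximalRealSubfield L)) L (IsCMField.complexConj L) 2).isUnitary_rightRegular μ).restrict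 _) (((quasiSplit (↥(maximalRealSubfield L)) L (IsCMField.complexConj L) 2).isStronglyContinuous_rightRegular_holds μ).restrict _ ((continuous_archToAdelic (↥(maximalRealSubfield L)) L (IsCMField.complexConj L) 2 ((StdForm.antidiagonal 2).over L)).comp (continuous_induced_rng.2 continuous_subtype_val))) μK χ₁ ∘L (((quasiSplit (↥(maximalRealSubfield L)) L (IsCMField.complexConj L) 2).rightRegular μ).restrict (archToAdelic (↥(maximalRealSubfield L)) L (IsCMField.complexConj L) 2 ((StdForm.antidiagonal 2).over L))).integratedOperator (((quasiSplit (↥(maximalRealSubfield L)) L (IsCMField.complexConj L) 2).isUnitary_rightRegular μ).restrict _) (((quasiSplit (↥(maximalRealSubfield L)) L (IsCMField.complexConj L) 2).isStronglyContinuous_rightRegular_holds μ).restrict _ (continuous_archToAdelic (↥(maximalRealSubfield L)) L (IsCMField.complexConj L) 2 ((StdForm.antidiagonal 2).over L))) νinf a ∘L (((quasiSplit (↥(maximalRealSubfield L)) L (IsCMField.complexConj L) 2).rightRegular μ).restrict ((archToAdelic (↥(maximalRealSubfield L)) L (IsCMField.complexConj L) 2 ((StdForm.antidiagonal 2).over L)).comp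 (Subgroup.inclusion (inf_le_left : UnitaryGroup.arch (↥(maximalRealSubfield L)) L (IsCMField.complexConj L) 2 ((StdForm.antidiagonal 2).over L) ⊓ unitaryGroupOfForm (conjMixed (↥(maximalRealSubfield L)) L (IsCMField.complexConj L)) 1 ≤ UnitaryGroup.arch (↥(maximalRealSubfield L)) L (IsCMField.complexConj L) 2 ((StdForm.antidiagonal 2).over L))))).integratedOperator (((quasiSplit (↥(maximalRealSubfield L)) L (IsCMField.complexConj L) 2).isUnitary_rightRegular μ).restrict _) (((quasiSplit (↥(maximalRealSubfield L)) L (IsCMField.complexConj L) 2).isStronglyContinuous_rightRegular_holds μ).restrict _ ((continuous_archToAdelic (↥(maximalRealSubfield L)) L (IsCMField.complexConj L) 2 ((StdForm.antidiagonal 2).over L)).comp (continuous_induced_rng.2 continuous_subtype_val))) μK χ₁ = (((quasiSplit (↥(maximalRealSubfield L)) L (IsCMField.complexConj L) 2).rightRegular μ).restrict (archToAdelic (↥(maximalRealSubfield L)) L (IsCMField.complexConj L) 2 ((StdForm.antidiagonal 2).over L))).integratedOperator (((quasiSplit (↥(maximalRealSubfield L)) L (IsCMField.complexConj L) 2).isUnitary_rightRegular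 μ).restrict _) (((quasiSplit (↥(maximalRealSubfield L)) L (IsCMField.complexConj L) 2).isStronglyContinuous_rightRegular_holds μ).restrict _ (continuous_archToAdelic (↥(maximalRealSubfield L)) L (IsCMField.complexConj L) 2 ((StdForm.antidiagonal 2).over L))) νinf an := by
  haveI : Measure.IsMulRightInvariant νinf := by
    have hinv : Measure.IsMulRightInvariant νinf.inv := inferInstance
    rwa [Measure.inv_eq_self] at hinv
  haveI : IsFiniteMeasureOnCompacts μK := ⟨fun K _ => measure_lt_top μK K⟩
  haveI : CompactSpace ↥(UnitaryGroup.arch (↥(maximalRealSubfield L)) L (IsCMField.complexConj L) 2 ((StdForm.antidiagonal 2).over L) ⊓ unitaryGroupOfForm (conjMixed (↥(maximalRealSubfield L)) L (IsCMField.complexConj L)) 1) := compactSpace_archUnitaryPoints ((StdForm.antidiagonal 2).over L)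
  obtain ⟨η, s, hηsymm, hηreal, hsd, hnc, hact, hright, hsupp⟩ := exists_gauge_selfConv L νinf νf νG hKcK hKinfKc U₀ hU₀o hU₀c hU₀Kc hVc
  -- ★ FILE 0 §6: `R(η) = R_∞(a) ∘L R_f(e)`
  obtain ⟨a, -, hbridge⟩ := exists_archFactor_integratedOperator_eq_arch_comp_level_free (L := L) (N := 2) (H := (StdForm.antidiagonal 2).over L)
    ((quasiSplit (↥(maximalRealSubfield L)) L (IsCMField.complexConj L) 2).rightRegular μ) ((quasiSplit (↥(maximalRealSubfield L)) L (IsCMField.complexConj L) 2).isUnitary_rightRegular μ) ((quasiSplit (↥(maximalRealSubfield L)) L (IsCMField.complexConj L) 2).isStronglyContinuous_rightRegular_holds μ) νinf νf νG hνG K' hK'o e he0 he1 heK η (fun b hb x => hright b ((hK'U₀ b).1 hb) x) (fun y hy => (hK'U₀ _).2 (hsupp y hy))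
  -- ★ the spherical compression of `a`
  obtain ⟨an, hanl, hanr, hcompr⟩ := exists_spherical_compression ((quasiSplit (↥(maximalRealSubfield L)) L (IsCMField.complexConj L) 2).rightRegular μ) ((quasiSplit (↥(maximalRealSubfield L)) L (IsCMField.complexConj L) 2).isUnitary_rightRegular μ) ((quasiSplit (↥(maximalRealSubfield L)) L (IsCMField.complexConj L) 2).isStronglyContinuous_rightRegular_holds μ) (archToAdelic (↥(maximalRealSubfield L)) L (IsCMField.complexConj L) 2 ((StdForm.antidiagonal 2).over L)) (continuous_archToAdelic (↥(maximalRealSubfield L)) L (IsCMField.complexConj L) 2 ((StdForm.antidiagonal 2).over L)) (Subgroup.inclusion (inf_le_left : UnitaryGroup.arch (↥(maximalRealSubfield L)) L (IsCMField.complexConj L) 2 ((StdForm.antidiagonal 2).over L) ⊓ unitaryGroupOfForm (conjMixed (↥(maximalRealSubfield L)) L (IsCMField.complexConj L)) 1 ≤ UnitaryGroup.arch (↥(maximalRealSubfield L)) L (IsCMField.complexConj L) 2 ((StdForm.antidiagonal 2).over L))) (continuous_induced_rng.2 continuous_subtype_val) μK χ₁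
    (fun k l => by rw [hχ1, hχ1, hχ1, one_mul]) νinf a
  exact ⟨η, s, a, an, hηsymm, hηreal, hsd, hnc, hact, hanl, hanr, hbridge, hcompr⟩

end Hecke

/-! ## §5 HEAD of FILE 1a: on `V_P` the spherical operator `T = R_∞(a♮) ∘L R_f(e)` of ★ p860902 acts as `P_1 ∘ R(η)` -/

section Head

variable (L : Type) [Field L] [NumberField L] [IsCMField L]
  [MeasurableSpace (quasiSplit (↥(maximalRealSubfield L)) L (IsCMField.complexConj L) 2).Adelic] [BorelSpace (quasiSplit (↥(maximalRealSubfield L)) L (IsCMField.complexConj L) 2).Adelic]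
  (μ : Measure (quasiSplit (↥(maximalRealSubfield L)) L (IsCMField.complexConj L) 2).automorphicQuotient) [(quasiSplit (↥(maximalRealSubfield L)) L (IsCMField.complexConj L) 2).IsAutomorphicMeasure μ]
  [MeasurableSpace (UnitaryGroup.arch (↥(maximalRealSubfield L)) L (IsCMField.complexConj L) 2 ((StdForm.antidiagonal 2).over L))] [BorelSpace (UnitaryGroup.arch (↥(maximalRealSubfield L)) L (IsCMField.complexConj L) 2 ((StdForm.antidiagonal 2).over L))]
  [MeasurableSpace (finAdelic (↥(maximalRealSubfield L)) L (IsCMField.complexConj L) 2 ((StdForm.antidiagonal 2).over L))] [BorelSpace (finAdelic (↥(maximalRealSubfield L)) L (IsCMField.complexConj L) 2 ((StdForm.antidiagonal 2).over L))]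
  (νinf : Measure (UnitaryGroup.arch (↥(maximalRealSubfield L)) L (IsCMField.complexConj L) 2 ((StdForm.antidiagonal 2).over L))) [IsHaarMeasure νinf] [νinf.IsInvInvariant] [SFinite νinf]
  (νf : Measure (finAdelic (↥(maximalRealSubfield L)) L (IsCMField.complexConj L) 2 ((StdForm.antidiagonal 2).over L))) [IsHaarMeasure νf] [SFinite νf]
  (νG : Measure (quasiSplit (↥(maximalRealSubfield L)) L (IsCMField.complexConj L) 2).Adelic) [νG.IsHaarMeasure]
  [MeasurableSpace ↥(UnitaryGroup.arch (↥(maximalRealSubfield L)) L (IsCMField.complexConj L) 2 ((StdForm.antidiagonal 2).over L) ⊓ unitaryGroupOfForm (conjMixed (↥(maximalRealSubfield L)) L (IsCMField.complexConj L)) 1)] [BorelSpace ↥(UnitaryGroup.arch (↥(maximalRealSubfield L)) L (IsCMField.complexConj L) 2 ((StdForm.antidiagonal 2).over L) ⊓ unitaryGroupOfForm (conjMixed (↥(maximalRealSubfield L)) L (IsCMField.complexConj L)) 1)]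
  (μK : Measure ↥(UnitaryGroup.arch (↥(maximalRealSubfield L)) L (IsCMField.complexConj L) 2 ((StdForm.antidiagonal 2).over L) ⊓ unitaryGroupOfForm (conjMixed (↥(maximalRealSubfield L)) L (IsCMField.complexConj L)) 1)) [IsProbabilityMeasure μK] [μK.IsMulLeftInvariant] [μK.IsMulRightInvariant]
  (χ₁ : C_c(↥(UnitaryGroup.arch (↥(maximalRealSubfield L)) L (IsCMField.complexConj L) 2 ((StdForm.antidiagonal 2).over L) ⊓ unitaryGroupOfForm (conjMixed (↥(maximalRealSubfield L)) L (IsCMField.complexConj L)) 1), ℂ)) (e : C_c(finAdelic (↥(maximalRealSubfield L)) L (IsCMField.complexConj L) 2 ((StdForm.antidiagonal 2).over L), ℂ))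

/-- **FILE 1a HEAD — THE OFF-DUAL HECKE OPERATOR ON `V_P`.**  For every Hecke character `χ`, every section level `K_c` (`K_c ≤ K`, `ι_∞(K_∞) ∩ K ⊆ K_c`, `ι_f(K′_f) ⊆ K_c`, continuous sections) and the
finite level `K′_f = U₀ ∩ G_f` (open compact `U₀ ≤ GL₂(𝔸_L^∞)`) with its normalised idempotent `e`: there are a real symmetric `η ∈ C_c(G(𝔸))` acting on every flat section of `V(χ, K_c, 1)`
by an ENTIRE NON-CONSTANT symbol `s`, and a SPHERICAL `a♮ ∈ C_c(G_∞)` (`hhl`∕`hhr` of ★ p860902 §3), such that the operator **`T := R_∞(a♮) ∘L R_f(e)`** bound by p860902 §3 satisfies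
**`T v = P_1 (R(η) v)` for every `v ∈ V_P`** (`P = P_1 ∘L R_f(e)`).  Assembly: §4 (gauge → FILE 0 bridge → compression) + §1 (`V_P ⊆ Fix(P_1) ∩ Fix(R_f e)`, ★ `kType_comp_self`,
★ `level_comp_self`, ★ `kType_comm_integratedOperator`). [cite: Knapp1986, VIII §3] [cite: Gelbart1975, (10.12)–(10.13)] [cite: BernsteinLapid2019, §4 Claim 1] -/
theorem exists_offDual_hecke_on_fix [MeasurableMul (finAdelic (↥(maximalRealSubfield L)) L (IsCMField.complexConj L) 2 ((StdForm.antidiagonal 2).over L))] (hχ1 : ∀ k, χ₁ k = 1)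
    (hνG : νG = (νinf.prod νf).map fun q => archToAdelic (↥(maximalRealSubfield L)) L (IsCMField.complexConj L) 2 ((StdForm.antidiagonal 2).over L) q.1 * finAdelicToAdelic (↥(maximalRealSubfield L)) L (IsCMField.complexConj L) 2 ((StdForm.antidiagonal 2).over L) q.2)
    (K' : Subgroup (finAdelic (↥(maximalRealSubfield L)) L (IsCMField.complexConj L) 2 ((StdForm.antidiagonal 2).over L))) (hK'o : IsOpen (K' : Set (finAdelic (↥(maximalRealSubfield L)) L (IsCMField.complexConj L) 2 ((StdForm.antidiagonal 2).over L))))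
    (he0 : ∀ x, x ∉ K' → e x = 0) (he1 : ∫ x, e x ∂νf = 1) (heK : ∀ k ∈ K', ∀ x, e (k * x) = e x)
    (U₀ : Subgroup (GL (Fin 2) (FiniteAdeleRing (𝓞 L) L))) (hU₀o : IsOpen (U₀ : Set (GL (Fin 2) (FiniteAdeleRing (𝓞 L) L)))) (hU₀c : IsCompact (U₀ : Set (GL (Fin 2) (FiniteAdeleRing (𝓞 L) L))))
    (hK'U₀ : ∀ b : finAdelic (↥(maximalRealSubfield L)) L (IsCMField.complexConj L) 2 ((StdForm.antidiagonal 2).over L), b ∈ K' ↔ (b : GL (Fin 2) (FiniteAdeleRing (𝓞 L) L)) ∈ U₀)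
    {χ : HeckeCharacter L} {Kc : Subgroup (quasiSplit (↥(maximalRealSubfield L)) L (IsCMField.complexConj L) 2).Adelic}
    (hKcK : Kc ≤ ((standardMaximalCompactGL 2 L).comap (adelicVal (↥(maximalRealSubfield L)) L (IsCMField.complexConj L) 2 ((StdForm.antidiagonal 2).over L)) : Subgroup (quasiSplit (↥(maximalRealSubfield L)) L (IsCMField.complexConj L) 2).Adelic))
    (hKinfKc : ∀ k : UnitaryGroup.arch (↥(maximalRealSubfield L)) L (IsCMField.complexConj L) 2 ((StdForm.antidiagonal 2).over L), adelicVal (↥(maximalRealSubfield L)) L (IsCMField.complexConj L) 2 ((StdForm.antidiagonal 2).over L) (archToAdelic (↥(maximalRealSubfield L)) L (IsCMField.complexConj L) 2 ((StdForm.antidiagonal 2).over L) k) ∈ standardMaximalCompactGL 2 L → archToAdelic (↥(maximalRealSubfield L)) L (IsCMField.complexConj L) 2 ((StdForm.antidiagonal 2).over L) k ∈ Kc)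
    (hU₀Kc : ∀ b : finAdelic (↥(maximalRealSubfield L)) L (IsCMField.complexConj L) 2 ((StdForm.antidiagonal 2).over L), (b : GL (Fin 2) (FiniteAdeleRing (𝓞 L) L)) ∈ U₀ → finAdelicToAdelic (↥(maximalRealSubfield L)) L (IsCMField.complexConj L) 2 ((StdForm.antidiagonal 2).over L) b ∈ Kc)
    (hVc : ∀ φ ∈ chiSectionSpace χ Kc 1, Continuous φ) :
    ∃ (η : C_c((quasiSplit (↥(maximalRealSubfield L)) L (IsCMField.complexConj L) 2).Adelic, ℂ)) (s : ℂ → ℂ) (an : C_c(UnitaryGroup.arch (↥(maximalRealSubfield L)) L (IsCMField.complexConj L) 2 ((StdForm.antidiagonal 2).over L), ℂ)),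
      (∀ g, η g⁻¹ = η g) ∧ (∀ g, conj (η g) = η g) ∧ Differentiable ℂ s ∧ (∃ z₁ z₂ : ℂ, s z₁ ≠ s z₂) ∧
      (∀ (z : ℂ), ∀ φ ∈ chiSectionSpace χ Kc 1, ∀ x : (quasiSplit (↥(maximalRealSubfield L)) L (IsCMField.complexConj L) 2).Adelic, (∫ y, η y * flatSectionU φ z (x * y) ∂νG) = s z * flatSectionU φ z x) ∧
      (∀ (k : ↥(UnitaryGroup.arch (↥(maximalRealSubfield L)) L (IsCMField.complexConj L) 2 ((StdForm.antidiagonal 2).over L) ⊓ unitaryGroupOfForm (conjMixed (↥(maximalRealSubfield L)) L (IsCMField.complexConj L)) 1)) (x : UnitaryGroup.arch (↥(maximalRealSubfield L)) L (IsCMField.complexConj L) 2 ((StdForm.antidiagonal 2).over L)), an ((Subgroup.inclusion (inf_le_left : UnitaryGroup.arch (↥(maximalRealSubfield L)) L (IsCMField.complexConj L) 2 ((StdForm.antidiagonal 2).over L) ⊓ unitaryGroupOfForm (conjMixed (↥(maximalRealSubfield L)) L (IsCMField.complexConj L)) 1 ≤ UnitaryGroup.arch (↥(maximalRealSubfield L))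 L (IsCMField.complexConj L) 2 ((StdForm.antidiagonal 2).over L))) k * x) = χ₁ k * an x) ∧
      (∀ (k : ↥(UnitaryGroup.arch (↥(maximalRealSubfield L)) L (IsCMField.complexConj L) 2 ((StdForm.antidiagonal 2).over L) ⊓ unitaryGroupOfForm (conjMixed (↥(maximalRealSubfield L)) L (IsCMField.complexConj L)) 1)) (x : UnitaryGroup.arch (↥(maximalRealSubfield L)) L (IsCMField.complexConj L) 2 ((StdForm.antidiagonal 2).over L)), an (x * (Subgroup.inclusion (inf_le_left : UnitaryGroup.arch (↥(maximalRealSubfield L)) L (IsCMField.complexConj L) 2 ((StdForm.antidiagonal 2).over L) ⊓ unitaryGroupOfForm (conjMixed (↥(maximalRealSubfield L)) L (IsCMField.complexConj L)) 1 ≤ UnitaryGroup.arch (↥(maximalRealSubfield L)) L (IsCMField.complexConj L) 2 ((StdForm.antidiagonal 2).over L))) k) = χ₁ k * an x) ∧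
      ∀ v ∈ LinearMap.eqLocus (((((quasiSplit (↥(maximalRealSubfield L)) L (IsCMField.complexConj L) 2).rightRegular μ).restrict ((archToAdelic (↥(maximalRealSubfield L)) L (IsCMField.complexConj L) 2 ((StdForm.antidiagonal 2).over L)).comp (Subgroup.inclusion (inf_le_left : UnitaryGroup.arch (↥(maximalRealSubfield L)) L (IsCMField.complexConj L) 2 ((StdForm.antidiagonal 2).over L) ⊓ unitaryGroupOfForm (conjMixed (↥(maximalRealSubfield L)) L (IsCMField.complexConj L)) 1 ≤ UnitaryGroup.arch (↥(maximalRealSubfield L)) L (IsCMField.complexConj L) 2 ((StdForm.antidiagonal 2).over L))))).integratedOperator (((quasiSplit (↥(maximalRealSubfield L)) L (IsCMField.complexConj L) 2).isUnitary_rightRegular μ).restrict _) (((quasiSplit (↥(maximalRealSubfield L)) L (IsCMField.complexConj L) 2).isStronglyContinuous_rightRegular_holds μ).restrict _ ((continuous_archToAdelic (↥(maximalRealSubfield L)) L (IsCMField.complexConj L) 2 ((StdForm.antidiagonal 2).over L)).comp (continuous_induced_rng.2 continuous_subtype_val))) μK χ₁ ∘L (((quasiSplit (↥(maximalRealSubfield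 L)) L (IsCMField.complexConj L) 2).rightRegular μ).restrict (finAdelicToAdelic (↥(maximalRealSubfield L)) L (IsCMField.complexConj L) 2 ((StdForm.antidiagonal 2).over L))).integratedOperator (((quasiSplit (↥(maximalRealSubfield L)) L (IsCMField.complexConj L) 2).isUnitary_rightRegular μ).restrict _) (((quasiSplit (↥(maximalRealSubfield L)) L (IsCMField.complexConj L) 2).isStronglyContinuous_rightRegular_holds μ).restrict _ (continuous_finAdelicToAdelic (↥(maximalRealSubfield L)) L (IsCMField.complexConj L) 2 ((StdForm.antidiagonal 2).over L))) νf e : (quasiSplit (↥(maximalRealSubfield L)) L (IsCMField.complexConj L) 2).L2 μ →L[ℂ] (quasiSplit (↥(maximalRealSubfield L)) L (IsCMField.complexConj L) 2).L2 μ) : (quasiSplit (↥(maximalRealSubfield L)) L (IsCMField.complexConj L) 2).L2 μ →ₗ[ℂ] (quasiSplit (↥(maximalRealSubfield L)) L (IsCMField.complexConj L) 2).L2 μ) LinearMap.id,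
        ((((quasiSplit (↥(maximalRealSubfield L)) L (IsCMField.complexConj L) 2).rightRegular μ).restrict (archToAdelic (↥(maximalRealSubfield L)) L (IsCMField.complexConj L) 2 ((StdForm.antidiagonal 2).over L))).integratedOperator (((quasiSplit (↥(maximalRealSubfield L)) L (IsCMField.complexConj L) 2).isUnitary_rightRegular μ).restrict _) (((quasiSplit (↥(maximalRealSubfield L)) L (IsCMField.complexConj L) 2).isStronglyContinuous_rightRegular_holds μ).restrict _ (continuous_archToAdelic (↥(maximalRealSubfield L)) L (IsCMField.complexConj L) 2 ((StdForm.antidiagonal 2).over L))) νinf an ∘L (((quasiSplit (↥(maximalRealSubfield L)) L (IsCMField.complexConj L) 2).rightRegular μ).restrict (finAdelicToAdelic (↥(maximalRealSubfield L)) L (IsCMField.complexConj L) 2 ((StdForm.antidiagonal 2).over L))).integratedOperator (((quasiSplit (↥(maximalRealSubfield L)) L (IsCMField.complexConj L) 2).isUnitary_rightRegular μ).restrict _) (((quasiSplit (↥(maximalRealSubfield L)) L (IsCMField.complexConj L) 2).isStronglyContinuous_rightRegular_holds μ).restrict _ (continuous_finAdelicToAdelic (↥(maximalRealSubfield L)) L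 (IsCMField.complexConj L) 2 ((StdForm.antidiagonal 2).over L))) νf e) v = (((quasiSplit (↥(maximalRealSubfield L)) L (IsCMField.complexConj L) 2).rightRegular μ).restrict ((archToAdelic (↥(maximalRealSubfield L)) L (IsCMField.complexConj L) 2 ((StdForm.antidiagonal 2).over L)).comp (Subgroup.inclusion (inf_le_left : UnitaryGroup.arch (↥(maximalRealSubfield L)) L (IsCMField.complexConj L) 2 ((StdForm.antidiagonal 2).over L) ⊓ unitaryGroupOfForm (conjMixed (↥(maximalRealSubfield L)) L (IsCMField.complexConj L)) 1 ≤ UnitaryGroup.arch (↥(maximalRealSubfield L)) L (IsCMField.complexConj L) 2 ((StdForm.antidiagonal 2).over L))))).integratedOperator (((quasiSplit (↥(maximalRealSubfield L)) L (IsCMField.complexConj L) 2).isUnitary_rightRegular μ).restrict _) (((quasiSplit (↥(maximalRealSubfield L)) L (IsCMField.complexConj L) 2).isStronglyContinuous_rightRegular_holds μ).restrict _ ((continuous_archToAdelic (↥(maximalRealSubfield L)) L (IsCMField.complexConj L) 2 ((StdForm.antidiagonal 2).over L)).comp (continuous_induced_rng.2 continuous_subtype_val))) μK χ₁ (((quasiSplit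 (↥(maximalRealSubfield L)) L (IsCMField.complexConj L) 2).rightRegular μ).integratedOperator ((quasiSplit (↥(maximalRealSubfield L)) L (IsCMField.complexConj L) 2).isUnitary_rightRegular μ) ((quasiSplit (↥(maximalRealSubfield L)) L (IsCMField.complexConj L) 2).isStronglyContinuous_rightRegular_holds μ) νG η v) := by
  obtain ⟨η, s, a, an, hηsymm, hηreal, hsd, hnc, hact, hanl, hanr, hbridge, hcompr⟩ :=
    exists_offDual_heckeOperator L μ νinf νf νG μK χ₁ e hχ1 hνG K' hK'o he0 he1 heK U₀ hU₀o hU₀c hK'U₀ hKcK hKinfKc hU₀Kc hVc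
  refine ⟨η, s, an, hηsymm, hηreal, hsd, hnc, hact, hanl, hanr, fun v hv => ?_⟩
  have hχmul : ∀ k l, χ₁ (k * l) = χ₁ k * χ₁ l := fun k l => by rw [hχ1, hχ1, hχ1, one_mul]
  have hP₁ := K2E1KTypeProjectorPureTensorU.kType_comp_self ((quasiSplit (↥(maximalRealSubfield L)) L (IsCMField.complexConj L) 2).rightRegular μ) ((quasiSplit (↥(maximalRealSubfield L)) L (IsCMField.complexConj L) 2).isUnitary_rightRegular μ) ((quasiSplit (↥(maximalRealSubfield L)) L (IsCMField.complexConj L) 2).isStronglyContinuous_rightRegular_holds μ) (archToAdelic (↥(maximalRealSubfield L)) L (IsCMField.complexConj L) 2 ((StdForm.antidiagonal 2).over L)) (continuous_archToAdelic (↥(maximalRealSubfield L)) L (IsCMField.complexConj L) 2 ((StdForm.antidiagonal 2).over L)) (Subgroup.inclusion (inf_le_left : UnitaryGroup.arch (↥(maximalRealSubfield L)) L (IsCMField.complexConj L) 2 ((StdForm.antidiagonal 2).over L) ⊓ unitaryGroupOfForm (conjMixed (↥(maximalRealSubfield L)) L (IsCMField.complexConj L)) 1 ≤ UnitaryGroup.arch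 (↥(maximalRealSubfield L)) L (IsCMField.complexConj L) 2 ((StdForm.antidiagonal 2).over L))) (continuous_induced_rng.2 continuous_subtype_val) μK χ₁ hχmul (hχ1 1)
  have hE := K2E1KTypeProjectorPureTensorU.level_comp_self (((quasiSplit (↥(maximalRealSubfield L)) L (IsCMField.complexConj L) 2).rightRegular μ).restrict (finAdelicToAdelic (↥(maximalRealSubfield L)) L (IsCMField.complexConj L) 2 ((StdForm.antidiagonal 2).over L))) (((quasiSplit (↥(maximalRealSubfield L)) L (IsCMField.complexConj L) 2).isUnitary_rightRegular μ).restrict _) (((quasiSplit (↥(maximalRealSubfield L)) L (IsCMField.complexConj L) 2).isStronglyContinuous_rightRegular_holds μ).restrict _ (continuous_finAdelicToAdelic (↥(maximalRealSubfield L)) L (IsCMField.complexConj L) 2 ((StdForm.antidiagonal 2).over L))) νf K' e he0 he1 heK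
  have hcomm := K2E1KTypeProjectorPureTensorU.kType_comm_integratedOperator ((quasiSplit (↥(maximalRealSubfield L)) L (IsCMField.complexConj L) 2).rightRegular μ) ((quasiSplit (↥(maximalRealSubfield L)) L (IsCMField.complexConj L) 2).isUnitary_rightRegular μ) ((quasiSplit (↥(maximalRealSubfield L)) L (IsCMField.complexConj L) 2).isStronglyContinuous_rightRegular_holds μ) (archToAdelic (↥(maximalRealSubfield L)) L (IsCMField.complexConj L) 2 ((StdForm.antidiagonal 2).over L)) (continuous_archToAdelic (↥(maximalRealSubfield L)) L (IsCMField.complexConj L) 2 ((StdForm.antidiagonal 2).over L)) (finAdelicToAdelic (↥(maximalRealSubfield L)) L (IsCMField.complexConj L) 2 ((StdForm.antidiagonal 2).over L)) (Subgroup.inclusion (inf_le_left : UnitaryGroup.arch (↥(maximalRealSubfield L)) L (IsCMField.complexConj L) 2 ((StdForm.antidiagonal 2).over L) ⊓ unitaryGroupOfForm (conjMixed (↥(maximalRealSubfield L)) L (IsCMField.complexConj L)) 1 ≤ UnitaryGroup.arch (↥(maximalRealSubfield L)) L (IsCMField.complexConj L) 2 ((StdForm.antidiagonal 2).over L))) (continuous_induced_rng.2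 continuous_subtype_val) μK χ₁ (continuous_finAdelicToAdelic (↥(maximalRealSubfield L)) L (IsCMField.complexConj L) 2 ((StdForm.antidiagonal 2).over L)) νf
    (fun x y => (commute_archToAdelic_finAdelicToAdelic (↥(maximalRealSubfield L)) L (IsCMField.complexConj L) 2 ((StdForm.antidiagonal 2).over L) x y).eq) e
  exact compressed_apply_of_fix _ _ _ _ _ hP₁ hE hcomm hcompr hbridge (LinearMap.mem_eqLocus.1 hv)

end Head

end Summit.HodgeConjecture.HodgeConjecture.Cruxes.H413.K2E1ResidualBlockPackageOffDualHeckeCMTwo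

end
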